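import Summits.SmoothPoincare4.SmoothPoincare4.Theses.CongruenceShadows

/-!
# `ShadowApproximation` — line `epi-class-livingston`: vocabulary (handlebody avatars, framings,
# Livingston–Zimmermann stable equivalence)

Definitions file of the proof line `epi-class-livingston` for the crux
`CongruenceShadows.ShadowApproximation` (item stmt-SmoothPoincare4-14595, route
route-SmoothPoincare4-CongruenceShadows; checked skeleton
`Cruxes/ShadowApproximation/Lines/epi-class-livingston.lean`, lead prover
prover-line-stmt-SmoothPoincare4-14595-0).  It carries ONLY the objects the line posits, so that
the registered stubs of the skeleton and the stub files `Theorems/CongruenceShadowsShadowApproximationStub*.lean`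
refer to the same declarations:

* `S m = SurfaceGroup (3+3m)`, `N m = s4Kernels.stabilizeIter m` (the standard `(3+3m; m+1)`
  kernel triple of `S⁴`), the normality instance `stdKernel_normal`, the standard handlebody groups
  `H m i = S m ⧸ N m i` (`π₁` of the `i`-th standard handlebody) and `T m = Π i, H m i`;
* the **standard handlebody avatar** `stdPhi m : S m →* T m`, `s ↦ (s mod N₀, s mod N₁, s mod N₂)`,
  and its image `Pstd m` (at `m = 0` the subdirect product
  `{x̄₁ = ȳ₁, x̄₂ = z̄₂, ȳ₃ = z̄₃} ≤ F₃³ ⊇ γ₂(F₃)³` of the idea card);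
* the crux hypotheses as predicates: `Pairs m K` (Waldhausen normalisation `hW`) and `Shadows m K`
  (standard shadows in every characteristic finite quotient, `hS`, verbatim);
* `IsFraming m K φ` — epimorphisms `φᵢ : S ↠ π₁(Hᵢ)` with `ker φᵢ = Kᵢ` and joint image `Pstd m`;
* `collapse3`, `collapseIter` — killing `3n` added handles `S_{g+3n} ↠ S_g` (from
  `surfaceRelator_add_three`), and **Livingston–Zimmermann stable equivalence**
  `StablyEquivalent m Φ Ψ` of homomorphisms out of `S m` (Livingston 1985, Zimmermann 1987; for `Ψ`
  onto `G` it is `Φ_*[Σ] = ±Ψ_*[Σ] ∈ H₂(G;ℤ)`, Dunfield–Thurston 2006 Thm 6.8 — used here only as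
  motivation: the predicate is typed without group homology);
* `SigmaStandard m Φ` (σ-standard: `β ∘ Φ` stably equivalent to `Φ_N` for some coordinate
  automorphisms `β`), `Equivalent m Φ` (`Φ_N = β ∘ Φ ∘ θ`);
* the three statement schemas of the line: `ConstantAvatarAt m` (dictionary / Nielsen level),
  `SeparationAt m` (load-bearing), `CancellationAt m` (residual).

No theorem of substance is proved here (only `rfl`/`simp` bookkeeping); the certificates
(`parts_of_crux`, `gate_of_parts`, …) live in the skeleton, the stubs in their own files.
Sources: Abrams–Gay–Kirby 2018 (arXiv:1605.06731) §1–2 for group trisections and `s4Kernels`;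
C. Livingston, *Stabilizing surface symmetries*, Michigan Math. J. 32 (1985); B. Zimmermann,
*Surfaces and the second homology of a group*, Monatsh. Math. 104 (1987); N. Dunfield,
W. Thurston, *Finite covers of random 3-manifolds*, Invent. Math. 166 (2006), §6.
-/

noncomputable section

-- the prescribed namespace `Summit.<P>.<Sub>.…` duplicates `SmoothPoincare4` (P = Sub)
set_option linter.dupNamespace false

namespace Summit.SmoothPoincare4.SmoothPoincare4.Theorems.ShadowApproximation.EpiClassLivingston

open Literature.Topology.FourManifolds

/-- `S_g` at the crux's genus `g = 3 + 3m`. -/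
abbrev S (m : ℕ) : Type := SurfaceGroup (3 + 3 * m)

/-- The standard kernel triple `N = s4Kernels # … # s4Kernels` of genus `3 + 3m`. -/
abbrev N (m : ℕ) : TrisectionKernels (3 + 3 * m) := s4Kernels.stabilizeIter m

/-- The standard kernels are normal closures, hence normal (so `S m ⧸ N m i` is a group). -/
instance stdKernel_normal (m : ℕ) (i : Fin 3) : (s4Kernels.stabilizeIter m i).Normal := by
  cases m with
  | zero =>
    show (s4Kernels i).Normal
    rw [s4Kernels_eq]
    infer_instance
  | succ n =>
    show ((s4Kernels.stabilizeIter n).stabilize i).Normal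
    rw [TrisectionKernels.stabilize_apply]
    infer_instance

/-- The `i`-th standard handlebody group `π₁(Hᵢ) = S ⧸ Nᵢ` (free of rank `3(m+1)` by
`IsGroupTrisection.free_quotient`; at `m = 0` it is `F₃` on the three surviving generators). -/
abbrev H (m : ℕ) (i : Fin 3) : Type := S m ⧸ N m i

/-- The target of handlebody avatars: `Π i, π₁(Hᵢ)` (at `m = 0`: `F₃ × F₃ × F₃`). -/
abbrev T (m : ℕ) : Type := ∀ i : Fin 3, H m i

/-- **The standard handlebody avatar** `Φ_N = (s ↦ s mod Nᵢ)ᵢ : S → Π π₁(Hᵢ)`. -/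
def stdPhi (m : ℕ) : S m →* T m :=
  MonoidHom.pi fun i => QuotientGroup.mk' (N m i)

/-- Coordinates of the standard avatar: `Φ_N(s)ᵢ = s mod Nᵢ`. [folklore] -/
@[simp] theorem stdPhi_apply (m : ℕ) (s : S m) (i : Fin 3) :
    stdPhi m s i = (s : H m i) := rfl

/-- **The standard joint image** `P_std = Φ_N(S) ≤ Π π₁(Hᵢ)` (at `m = 0` the subdirect product
`{x̄₁ = ȳ₁, x̄₂ = z̄₂, ȳ₃ = z̄₃} ≤ F₃³`, containing `γ₂(F₃)³`). -/
def Pstd (m : ℕ) : Subgroup (T m) := (stdPhi m).range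

/-- Waldhausen normalisation (the crux's `hW`): each pair of slots simultaneously standard. -/
def Pairs (m : ℕ) (K : TrisectionKernels (3 + 3 * m)) : Prop :=
  ∀ i j : Fin 3, i ≠ j → ∃ α : S m ≃* S m,
    (N m i).map α.toMonoidHom = K i ∧ (N m j).map α.toMonoidHom = K j

/-- Standard shadows in every characteristic finite quotient (the crux's `hS`, VERBATIM: the level
symmetry is whatever `ψ` induces — not required to lift anywhere). -/
def Shadows (m : ℕ) (K : TrisectionKernels (3 + 3 * m)) : Prop :=
  ∀ M : Subgroup (S m), M.Characteristic → M.FiniteIndex →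
    ∃ ψ : S m ≃* S m, ∀ i : Fin 3, (N m i ⊔ M).map ψ.toMonoidHom = K i ⊔ M

/-- Genus bookkeeping is definitional: `N 0 = s4Kernels` (and `S 0 = SurfaceGroup 3`, `3 + 3·0 = 3`). -/
theorem N_zero : N 0 = s4Kernels := rfl



/-- **Framing** of a kernel triple by the standard handlebody groups: epimorphisms
`φᵢ : S → π₁(Hᵢ^N)` with `ker φᵢ = Kᵢ` whose JOINT image is the standard one, `Φ_K(S) = P_std`. -/
def IsFraming (m : ℕ) (K : TrisectionKernels (3 + 3 * m)) (φ : ∀ i : Fin 3, S m →* H m i) : Prop :=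
  (∀ i, (φ i).ker = K i) ∧ (MonoidHom.pi φ).range = Pstd m

/-! ### Killing handles, and Livingston–Zimmermann stable equivalence -/

/-- Generator images of the collapse `S_{g+3} → S_g`: keep the first `g` handles, kill the last
three. -/
def keepFun (g : ℕ) (c : surfaceGen (g + 3)) : SurfaceGroup g :=
  Fin.append (fun i : Fin g => (PresentedGroup.of (i, c.2) : SurfaceGroup g))
    (fun _ : Fin 3 => (1 : SurfaceGroup g)) c.1

/-- The free lift of `keepFun` restricted to the first `g` handles is the projection `F → S_g`. [folklore] -/
theorem lift_keepFun_comp_genIncl (g : ℕ) :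
    (FreeGroup.lift (keepFun g)).comp (genIncl g) = PresentedGroup.mk _ :=
  FreeGroup.ext_hom _ _ fun p => by simp [keepFun, PresentedGroup.of]

/-- The free lift of `keepFun` kills the last three handles. [folklore] -/
theorem lift_keepFun_comp_genShift (g : ℕ) :
    (FreeGroup.lift (keepFun g)).comp (genShift g) = 1 :=
  FreeGroup.ext_hom _ _ fun p => by simp [keepFun]

/-- Pointwise form of `lift_keepFun_comp_genIncl`. [folklore] -/
theorem lift_keepFun_genIncl (g : ℕ) (x : FreeGroup (surfaceGen g)) :
    FreeGroup.lift (keepFun g) (genIncl g x) = PresentedGroup.mk _ x :=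
  DFunLike.congr_fun (lift_keepFun_comp_genIncl g) x

/-- Pointwise form of `lift_keepFun_comp_genShift`. [folklore] -/
theorem lift_keepFun_genShift (g : ℕ) (x : FreeGroup (surfaceGen 3)) :
    FreeGroup.lift (keepFun g) (genShift g x) = 1 :=
  DFunLike.congr_fun (lift_keepFun_comp_genShift g) x

/-- **Collapse of the last three handles** `S_{g+3} ↠ S_g` (`aⱼ, bⱼ ↦ aⱼ, bⱼ` for `j < g`,
`a_{g+k}, b_{g+k} ↦ 1`): the relator `r_{g+3} = ι(r_g)·σ(r_3)` dies. On `π₁` this is the map of the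
degree-one collapse `Σ_{g+3} = Σ_g # Σ_3 → Σ_g`. -/
def collapse3 (g : ℕ) : SurfaceGroup (g + 3) →* SurfaceGroup g :=
  presentedLift (FreeGroup.lift (keepFun g)) (by
    intro r hr
    rw [Set.mem_singleton_iff] at hr
    subst hr
    rw [surfaceRelator_add_three, map_mul, lift_keepFun_genIncl, lift_keepFun_genShift,
      PresentedGroup.one_of_mem (Set.mem_singleton _), one_mul])

/-- `collapse3` is the identity on the first `g` handles. [folklore] -/
@[simp] theorem collapse3_of_castAdd (g : ℕ) (i : Fin g) (s : Bool) :
    collapse3 g (PresentedGroup.of (Fin.castAdd 3 i, s)) = PresentedGroup.of (i, s) := by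
  simp [collapse3, keepFun, PresentedGroup.of]

/-- `collapse3` kills the last three handles. [folklore] -/
@[simp] theorem collapse3_of_natAdd (g : ℕ) (j : Fin 3) (s : Bool) :
    collapse3 g (PresentedGroup.of (Fin.natAdd g j, s)) = 1 := by
  simp [collapse3, keepFun, PresentedGroup.of]

/-- Collapse of `3n` added handles, `S_{g+3n} ↠ S_g` (Livingston's stabilisation by trivially mapped
handles, three at a time — any cofinal stabilisation scheme gives the same stable relation). -/
def collapseIter (g : ℕ) : (n : ℕ) → (SurfaceGroup (g + 3 * n) →* SurfaceGroup g)
  | 0 => MonoidHom.id _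
  | n + 1 => (collapseIter g n).comp (collapse3 (g + 3 * n))

/-- Zero-fold collapse is the identity. [folklore] -/
@[simp] theorem collapseIter_zero (g : ℕ) : collapseIter g 0 = MonoidHom.id _ := rfl

/-- Unfolding one step of `collapseIter`. [folklore] -/
theorem collapseIter_succ (g n : ℕ) :
    collapseIter g (n + 1) = (collapseIter g n).comp (collapse3 (g + 3 * n)) := rfl

/-- **Livingston–Zimmermann stable equivalence** of two homomorphisms `S_{3+3m} → G`: after adding
`3n` handles mapped trivially they differ by an automorphism (`±` mapping class, Dehn–Nielsen–Baer)
of the stabilised surface group. For `Ψ` onto `G` this is equivalent to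
`Φ_*[Σ] = ±Ψ_*[Σ] ∈ H₂(G;ℤ)` (Livingston 1985, Zimmermann 1987; Dunfield–Thurston 2006 Thm 6.8:
bordism over `K(G,1)` = `H₂`, plus handle cancellation in the bordism). -/
def StablyEquivalent (m : ℕ) {G : Type*} [Group G] (Φ Ψ : S m →* G) : Prop :=
  ∃ (n : ℕ) (θ : SurfaceGroup (3 + 3 * m + 3 * n) ≃* SurfaceGroup (3 + 3 * m + 3 * n)),
    (Φ.comp (collapseIter (3 + 3 * m) n)).comp θ.toMonoidHom = Ψ.comp (collapseIter (3 + 3 * m) n)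

/-- Stable equivalence is reflexive (`n = 0`, `θ = 1`). [folklore] -/
theorem StablyEquivalent.refl (m : ℕ) {G : Type*} [Group G] (Φ : S m →* G) :
    StablyEquivalent m Φ Φ :=
  ⟨0, MulEquiv.refl _, MonoidHom.ext fun _ => rfl⟩

/-- **σ-standard** (the Livingston class of `Φ` is standard up to target framings):
`∃ β ∈ Π Aut π₁(Hᵢ)`, `β ∘ Φ` is stably equivalent to `Φ_N`. For `Φ` onto `P_std` this says
`σ(Φ) := Φ_*[Σ] ∈ ±Aut_Λ · σ(Φ_N)` in `H₂(P_std;ℤ) = H₂(E_Λ;ℤ)`, `E_Λ` the `ℤ³`-cover of `R₃³`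
(card), where `Aut_Λ = Stab_{Π Aut Fᵢ}(P_std)` (a `β` that works stabilises `P_std` automatically,
stable equivalence preserving images). -/
def SigmaStandard (m : ℕ) (Φ : S m →* T m) : Prop :=
  ∃ β : ∀ i : Fin 3, H m i ≃* H m i,
    StablyEquivalent m ((MulEquiv.piCongrRight β).toMonoidHom.comp Φ) (stdPhi m)

/-- **Equivalent to the standard avatar**: `Φ_N = β ∘ Φ ∘ θ` with `θ ∈ Aut S`, `β ∈ Π Aut π₁(Hᵢ)`
(`Φ ∈ Aut_Λ · Φ_N · Aut S`: the orbit whose transitivity on `Epi(S₃, P_std)` is `UnstableGate₃`,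
triage F2/N3). -/
def Equivalent (m : ℕ) (Φ : S m →* T m) : Prop :=
  ∃ (θ : S m ≃* S m) (β : ∀ i : Fin 3, H m i ≃* H m i),
    ∀ s : S m, stdPhi m s = MulEquiv.piCongrRight β (Φ (θ s))

/-! ## 1. Statements of the stubs -/

/-- Statement of `stub_constantAvatarZero` / `stub_constantAvatarPos` at genus `3 + 3m`
(the DICTIONARY `kernel triples ↦ Epi(S, P_std)`): a Waldhausen-normalised, shadow-standard
`(3+3m; m+1)` group trisection of `{1}` admits a framing with the STANDARD joint image. At `m = 0`:
lattice identity `[S,S] ≤ Kᵢ(Kⱼ ∩ Kₗ)` (proved) ⟹ `Φ_K(S) ⊇ γ₂(F₃)³`, so the joint image is the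
preimage of the abelian shadow, which is standard (route support `AbelianShadowStandard` at `m = 0`
/ `hS` at the levels `[S,S]S^n` + class number one, triage N4) — then re-frame by `Aut F₃ ↠ GL₃(ℤ)`.
At `m ≥ 1` it is the Nielsen-level statement that the framed joint image `S/(K₀∩K₁∩K₂)` is
standard (implied by the crux; sibling line `free-shadow-tsystem` territory). -/
def ConstantAvatarAt (m : ℕ) : Prop :=
  ∀ K : TrisectionKernels (3 + 3 * m), IsGroupTrisection (3 + 3 * m) (m + 1) (PUnit : Type) K →
    Pairs m K → Shadows m K → ∃ φ : ∀ i : Fin 3, S m →* H m i, IsFraming m K φ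

/-- Statement of `stub_separation` at genus `3 + 3m` (SEPARATION, the load-bearing bet): for a
framed, normalised group trisection of `{1}`, standard shadows in every characteristic finite
quotient force the Livingston class to be standard — `σ(Φ_K) ∈ ±Aut_Λ·σ(Φ_N)`, typed as stable
equivalence. A local-to-global statement for ONE class in the torsion `ℤ[t₁±,t₂±,t₃±]`-module
`H₂(E_Λ;ℤ)` under the level symmetries (units included: `hS` is consumed verbatim). -/
def SeparationAt (m : ℕ) : Prop :=
  ∀ (K : TrisectionKernels (3 + 3 * m)) (φ : ∀ i : Fin 3, S m →* H m i),
    IsGroupTrisection (3 + 3 * m) (m + 1) (PUnit : Type) K → Pairs m K → Shadows m K →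
    IsFraming m K φ → SigmaStandard m (MonoidHom.pi φ)

/-- Statement of `stub_cancellation` at genus `3 + 3m` (CANCELLATION, the honest residual):
a framed, normalised, shadow-standard group trisection of `{1}` whose avatar is Livingston-stably
standard IS standard — destabilisation of trivially mapped handle triples (by bordism = homology:
simplify the 3-manifold `W`, `∂W = Σ ⊔ Σ̄`, carrying three surface systems interpolating the two
trisection diagrams). Crux-strength on the σ-standard locus (conceded by the card). -/
def CancellationAt (m : ℕ) : Prop :=
  ∀ (K : TrisectionKernels (3 + 3 * m)) (φ : ∀ i : Fin 3, S m →* H m i),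
    IsGroupTrisection (3 + 3 * m) (m + 1) (PUnit : Type) K → Pairs m K → Shadows m K →
    IsFraming m K φ → SigmaStandard m (MonoidHom.pi φ) → Equivalent m (MonoidHom.pi φ)

/-- Registration anchor of this vocabulary file (the gate requires every `--supports` file of a
crux with registered stubs to prove a registered name + signature; this `rfl` is registered by
`ledger workitem stub-add` for exactly that purpose and carries no mathematical content). [folklore] -/
theorem vocabulary_anchor : Pstd 0 = (stdPhi 0).range := rfl

end Summit.SmoothPoincare4.SmoothPoincare4.Theorems.ShadowApproximation.EpiClassLivingston

end
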